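import Mathlib
import HarnessLib
import Summits.HubbardSuperconductivity.HubbardSuperconductivity.Theorems.KLProgrammeC4aPartnerBandTangencyDefectSharp
import Summits.HubbardSuperconductivity.HubbardSuperconductivity.Theorems.KLProgrammeC4aPartnerBandJetCounting

/-!
# Route `KLProgramme` — crux C4a, S3 brick (B4, DIRECT SHEET): the OFFSET ROW — reduction `ρ → 0` of the co-moving jets of the pp partner band at FIXED `ϑ`,
# every order `k ≤ 4`, radial rows only up to the order

Cell `gate-hubbard-kl`, seat hubbard-kl-k3c3-p3 (g25; row «implicit-function / monotonicity route for μ(n)»).  Located brick «(B4)-DIRECT-COUNT»; completes the transport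
of the two-node control (`…C4aTwoNodeControl`, stated at `ρ = 0`) to the slice tube `|ρ| ≤ r_n`: with `T_k(ρ,ϑ,e) := ∂ᵏ_t|₀ e_K(S_{ρϑθ}(t) − Φ(e, φ+θ+t))`,

* **`abs_iteratedDeriv_partnerBand_pp_sub_offset_le_sharp`** — `|T_k(ρ,ϑ,e) − T_k(0,ϑ,e)| ≤ |ρ|·(k+1)!·𝒦·R·Dᵏ` whenever `3·msD6 j + |ρ|·RRⱼ ≤ Dʲ` (`1 ≤ j ≤ k`) and
  `RRⱼ ≤ R·Dʲ` (`j ≤ k`), the radial rows `‖Φ_ρ⁽ʲ⁾ − Φ_0⁽ʲ⁾‖ ≤ RRⱼ·|ρ|` entering only up to order `k` (rows `0…3` are in the tree: `norm_levelPoint_sub_levelPoint_le`,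
  `norm_iteratedDeriv_one/two/three_levelPoint_sub_le` ⇒ `k ≤ 3` unconditional; `k = 4` needs `RR₄`).

It is the twin of `…C4aPartnerBandTangencyDefectSharp.abs_iteratedDeriv_partnerBand_pp_sub_level_le_sharp` (reduction `e → 0` in the LOOP slot) with the displacement
in the PARTNER-LEG slot: `S_{ρϑθ}(t) − S_{0ϑθ}(t) = Φ_ρ(ϑ+θ+t) − Φ_0(ϑ+θ+t)`, same sharp comparison `abs_iteratedDeriv_comp_add_smul_sub_le_sharp`; unlike the landed
configuration reduction `…_sub_config_le_sharp` it keeps `ϑ` (the reference configuration `(0, ϑ)` is the one where the two direct crossings are both at loop level `0`,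
which is what the two-node / transversal-zero controls use).  Together: `|∂ᵐ_θ ē(e,φ;ρ,ϑ,θ)| ≤ |∂ᵐ_θ ē(0,φ;0,ϑ,θ)| + ℓ_m^e·|e| + ℓ_m^ρ·|ρ| ≤ C_m·(|ē| + |e| + |ρ|)` — the KEY
LEMMA of B4-DIRECT-COUNT.md §1 on the direct sheet, modulo the mixed-jet ceiling.

Binder shape = `…C4aPathJetsSix` / `…TangencyDefectSharp` (`hA hA20 hd hr hlo hhi hA₃ hA₄ hA₅ hA₆`).  Pure bookkeeping on landed objects; nothing about the model's sizes;
nothing asserts (C), K3 or superconductivity.  References: FST II CPAM 51 (1998) §3; BGM 2006 §2.4 Lemma 2.1 (2.40) [cite: BenfattoGiulianiMastropietro2006].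
-/

noncomputable section

namespace Summit.HubbardSuperconductivity.HubbardSuperconductivity.Theorems.C4a

set_option linter.dupNamespace false -- summit = problem name (single-conjunct summit), D-0017

open Real Set Filter
open scoped Topology
open Literature.MathematicalPhysics.QuantumLattice Literature.MathematicalPhysics.QuantumLattice.BandSectorCounting Literature.Probability.LatticeModels
open Summit.HubbardSuperconductivity.HubbardSuperconductivity.Theorems.KLRegimeSplit
open Summit.HubbardSuperconductivity.HubbardSuperconductivity.Theorems.DispersionFlow
open Summit.HubbardSuperconductivity.HubbardSuperconductivity.Theorems.PerturbedFermiCurve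

/-- The pair-sum paths at offsets `ρ` and `0` differ by the partner leg's radial displacement: `S_{ρϑθ}(t) − Φ(e,φ+θ+t) = (S_{0ϑθ}(t) − Φ(e,φ+θ+t)) + (Φ_ρ − Φ_0)(ϑ+θ+t)`. -/
theorem pairSumPath_sub_levelPoint_eq_zero_offset_add (μ : ℝ) (K : TrigPolyC4v) (ρ ϑ θ e φ t : ℝ) :
    pairSumPath μ K ρ ϑ θ t - levelPoint μ K e (φ + θ + t) =
      (pairSumPath μ K 0 ϑ θ t - levelPoint μ K e (φ + θ + t)) + (levelPoint μ K ρ (ϑ + θ + t) - levelPoint μ K 0 (ϑ + θ + t)) := by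
  simp only [pairSumPath]; abel

section Sizes

variable {K : TrigPolyC4v} {A : ℝ} (hA : ∀ p : Momentum, ∀ j ≤ 2, ‖iteratedFDeriv ℝ j (frameShift K) p‖ ≤ A) (hA20 : A ≤ 1 / 20)
  (hd : klCurveD ≤ (bandBounds (show (-4 : ℝ) < -1.1 by norm_num) (show (-1.1 : ℝ) ≤ -0.1 by norm_num)
    (show (-0.1 : ℝ) < 0 by norm_num)).Dtmin - 2 * A)
  {μ r : ℝ} (hr : 0 < r) (hlo : (-1.1 : ℝ) < μ - r - A) (hhi : μ + r + A < -0.1)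
  {A₃ A₄ A₅ A₆ : ℝ} (hA₃ : ∀ p : Momentum, ‖iteratedFDeriv ℝ 3 (frameShift K) p‖ ≤ A₃)
  (hA₄ : ∀ p : Momentum, ‖iteratedFDeriv ℝ 4 (frameShift K) p‖ ≤ A₄)
  (hA₅ : ∀ p : Momentum, ‖iteratedFDeriv ℝ 5 (frameShift K) p‖ ≤ A₅)
  (hA₆ : ∀ p : Momentum, ‖iteratedFDeriv ℝ 6 (frameShift K) p‖ ≤ A₆)
include hA hA20 hd hr hlo hhi hA₃ hA₄ hA₅ hA₆

/-- **SHARP REDUCTION `ρ → 0` AT FIXED `ϑ`, ORDER `k ≤ 4` (pp, loop at level `e`)**: rows `RRⱼ` (`j ≤ k`) of the partner leg only. -/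
theorem abs_iteratedDeriv_partnerBand_pp_sub_offset_le_sharp {k : ℕ} (hk : k ≤ 4) {𝒦 : ℝ}
    (hK : ∀ i, 1 ≤ i → i ≤ k + 1 → ∀ p : Momentum, ‖iteratedFDeriv ℝ i (frameLevel μ K) p‖ ≤ 𝒦)
    {ρ : ℝ} (hρ : |ρ| < r) {e : ℝ} (he : |e| < r) {RR : ℕ → ℝ}
    (hRR : ∀ i, i ≤ k → ∀ s, ‖iteratedDeriv i (levelPoint μ K ρ) s - iteratedDeriv i (levelPoint μ K 0) s‖ ≤ RR i * |ρ|)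
    {D R : ℝ} (hD0 : 0 ≤ D) (hR0 : 0 ≤ R) (hDrow : ∀ j, 1 ≤ j → j ≤ k → 3 * msD6 A₃ A₄ A₅ A₆ j + |ρ| * RR j ≤ D ^ j)
    (hRrow : ∀ j, j ≤ k → RR j ≤ R * D ^ j) (ϑ θ φ : ℝ) :
    |iteratedDeriv k (fun t : ℝ => frameLevel μ K (pairSumPath μ K ρ ϑ θ t - levelPoint μ K e (φ + θ + t))) 0 -
      iteratedDeriv k (fun t : ℝ => frameLevel μ K (pairSumPath μ K 0 ϑ θ t - levelPoint μ K e (φ + θ + t))) 0| ≤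
      |ρ| * ((k + 1).factorial * 𝒦 * R * D ^ k) := by
  set B₀ := bandBounds (show (-4 : ℝ) < -1.1 by norm_num) (show (-1.1 : ℝ) ≤ -0.1 by norm_num) (show (-0.1 : ℝ) < 0 by norm_num) with hB₀
  have hADt : 2 * A < B₀.Dtmin := by have := klCurveD_pos; linarith
  have h0 : |(0 : ℝ)| < r := by simpa using hr
  have _hk := hk
  by_cases hρ0 : ρ = 0
  · subst hρ0; simp
  set X : ℝ → Momentum := fun t => pairSumPath μ K 0 ϑ θ t - levelPoint μ K e (φ + θ + t) with hX
  set G : ℝ → Momentum := fun t => levelPoint μ K ρ (ϑ + θ + t) - levelPoint μ K 0 (ϑ + θ + t) with hG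
  set Δ : ℝ → Momentum := ρ⁻¹ • G with hΔ
  have hXc : ContDiff ℝ (k + 1 : ℕ) X := (contDiff_pairSumPath B₀ hA hADt hr hlo hhi h0 ϑ θ).sub
    ((contDiff_levelPoint_of_sizes hA hd hlo hhi he (k + 1)).comp (contDiff_const.add contDiff_id))
  have hGc : ContDiff ℝ (k + 1 : ℕ) G := ((contDiff_levelPoint_of_sizes hA hd hlo hhi hρ (k + 1)).comp (contDiff_const.add contDiff_id)).sub
    ((contDiff_levelPoint_of_sizes hA hd hlo hhi h0 (k + 1)).comp (contDiff_const.add contDiff_id))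
  have hΔc : ContDiff ℝ (k + 1 : ℕ) Δ := hGc.const_smul ρ⁻¹
  have hfun : (fun t : ℝ => frameLevel μ K (pairSumPath μ K ρ ϑ θ t - levelPoint μ K e (φ + θ + t))) =
      fun t : ℝ => frameLevel μ K (X t + ρ • Δ t) := by
    funext t
    rw [pairSumPath_sub_levelPoint_eq_zero_offset_add]
    simp only [hX, hG, hΔ, Pi.smul_apply, smul_smul, mul_inv_cancel₀ hρ0, one_smul]
  have hfun0 : (fun t : ℝ => frameLevel μ K (pairSumPath μ K 0 ϑ θ t - levelPoint μ K e (φ + θ + t))) =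
      fun t : ℝ => frameLevel μ K (X t) := rfl
  rw [hfun, hfun0]
  have hΔj : ∀ j, j ≤ k → ‖iteratedDeriv j Δ 0‖ ≤ RR j := fun j hj => by
    have hGj : ContDiffAt ℝ j G 0 := (hGc.of_le (by exact_mod_cast (hj.trans (Nat.le_succ k)))).contDiffAt
    rw [hΔ, iteratedDeriv_const_smul hGj, hG, iteratedDeriv_levelPoint_sub_levelPoint_shift_zero hA hd hlo hhi hρ h0 (ϑ + θ) j,
      norm_smul, norm_inv, Real.norm_eq_abs]
    have h := hRR j hj (ϑ + θ)
    have hρpos : 0 < |ρ| := abs_pos.2 hρ0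
    rw [inv_mul_le_iff₀ hρpos, mul_comm]
    exact h
  refine abs_iteratedDeriv_comp_add_smul_sub_le_sharp (EngineV8.contDiff_frameLevel μ K (n := (k + 1 : ℕ))) le_rfl hK hXc hΔc ρ hD0 hR0
    (fun j hj1 hj => le_trans ?_ (hDrow j hj1 hj)) (fun j hj => (hΔj j hj).trans (hRrow j hj))
  have hXj : ‖iteratedDeriv j X 0‖ ≤ 3 * msD6 A₃ A₄ A₅ A₆ j := by
    rw [hX, iteratedDeriv_pairSumPath_sub_levelPoint_zero hA hd hr hlo hhi h0 he ϑ θ φ j]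
    have h1 := norm_iteratedDeriv_levelPoint_le_six hA hA20 hd hlo hhi hA₃ hA₄ hA₅ hA₆ h0 hj1 (by omega) θ
    have h2 := norm_iteratedDeriv_levelPoint_le_six hA hA20 hd hlo hhi hA₃ hA₄ hA₅ hA₆ h0 hj1 (by omega) (ϑ + θ)
    have h3 := norm_iteratedDeriv_levelPoint_le_six hA hA20 hd hlo hhi hA₃ hA₄ hA₅ hA₆ he hj1 (by omega) (φ + θ)
    have := norm_sub_le (iteratedDeriv j (levelPoint μ K 0) θ + iteratedDeriv j (levelPoint μ K 0) (ϑ + θ)) (iteratedDeriv j (levelPoint μ K e) (φ + θ))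
    have := norm_add_le (iteratedDeriv j (levelPoint μ K 0) θ) (iteratedDeriv j (levelPoint μ K 0) (ϑ + θ))
    linarith
  have t1 := hΔj j hj
  nlinarith [abs_nonneg ρ, mul_le_mul_of_nonneg_left t1 (abs_nonneg ρ)]

/-- **The offset row in base-angle form** (translation `ψ = θ + t`, `…C4aPartnerBandJetCounting.iteratedDeriv_partnerBand_pp_base_eq`): the `m`-th base-angle jet of
`ψ ↦ e_K(Φ(0,ψ) + Φ(ρ,ϑ+ψ) − Φ(e,φ+ψ))` at `θ` differs from its `ρ = 0` value by at most `|ρ|·(k+1)!·𝒦·R·Dᵏ`. -/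
theorem abs_iteratedDeriv_partnerBand_pp_base_sub_offset_le {k : ℕ} (hk : k ≤ 4) {𝒦 : ℝ}
    (hK : ∀ i, 1 ≤ i → i ≤ k + 1 → ∀ p : Momentum, ‖iteratedFDeriv ℝ i (frameLevel μ K) p‖ ≤ 𝒦)
    {ρ : ℝ} (hρ : |ρ| < r) {e : ℝ} (he : |e| < r) {RR : ℕ → ℝ}
    (hRR : ∀ i, i ≤ k → ∀ s, ‖iteratedDeriv i (levelPoint μ K ρ) s - iteratedDeriv i (levelPoint μ K 0) s‖ ≤ RR i * |ρ|)
    {D R : ℝ} (hD0 : 0 ≤ D) (hR0 : 0 ≤ R) (hDrow : ∀ j, 1 ≤ j → j ≤ k → 3 * msD6 A₃ A₄ A₅ A₆ j + |ρ| * RR j ≤ D ^ j)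
    (hRrow : ∀ j, j ≤ k → RR j ≤ R * D ^ j) (ϑ θ φ : ℝ) :
    |iteratedDeriv k (fun ψ : ℝ => frameLevel μ K (levelPoint μ K 0 ψ + levelPoint μ K ρ (ϑ + ψ) - levelPoint μ K e (φ + ψ))) θ -
      iteratedDeriv k (fun ψ : ℝ => frameLevel μ K (levelPoint μ K 0 ψ + levelPoint μ K 0 (ϑ + ψ) - levelPoint μ K e (φ + ψ))) θ| ≤
      |ρ| * ((k + 1).factorial * 𝒦 * R * D ^ k) := by
  rw [iteratedDeriv_partnerBand_pp_base_eq μ K ρ ϑ e φ θ k, iteratedDeriv_partnerBand_pp_base_eq μ K 0 ϑ e φ θ k]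
  exact abs_iteratedDeriv_partnerBand_pp_sub_offset_le_sharp hA hA20 hd hr hlo hhi hA₃ hA₄ hA₅ hA₆ hk hK hρ he hRR hD0 hR0 hDrow hRrow ϑ θ φ

end Sizes

end Summit.HubbardSuperconductivity.HubbardSuperconductivity.Theorems.C4a

end
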